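import Summits.RiemannHypothesis.RiemannHypothesis.Theorems.PfPersistenceRatioDegenerateWindow
import Summits.RiemannHypothesis.RiemannHypothesis.Theorems.PfPersistenceRatioNearPositivity
import HarnessLib

/-!
# PF persistence — the `(Z)`-cell ∀-window half RE-RUN over the GUARDED classes (pub-rhpf barrier-prover, gen 5;
RULING A324 (3)(b)(d) on GAP-CLASSES G1.21b-RATIO-AW)

**HONEST FRAMING. Mechanism / rigidity campaign; no RH claims.** RH-free, sorry-free, no numerical datum used.

`PfPersistenceRatioDegenerateWindow` recorded why the unguarded `GaugeRatioClass τ` / `ModulusRatioClass κ` are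
the wrong quantifier (`N = 0` windows force a zero entry) and defined the GUARDED classes
`GaugeRatioClassPos τ = {d | ∀ win, 0 < win.N → |ε₁| ≤ τ(ε₂ − ε₁)}`, `ModulusRatioClassPos κ` likewise. This file
re-runs the ∀-window half of the `(Z)`-cell against them. The binder windows of `ClusterBinders` / `ClusterReady`
carry an orthogonal pair of non-zero vectors, hence have `0 < N` AUTOMATICALLY (`pos_of_orth_pair`) — no new
binder field is needed:

* §1 (PROVED) dial isolation, sequence form: under `ClusterBinders q W ρ C` (`τC < ρ(1 − τ)`, resp. `κC < ρ`)
  every up-dial amplitude is rejected at some binder window WITH `0 < N`, so no up-dial of `ζ` at `q` lies in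
  `GaugeRatioClassPos τ` / `ModulusRatioClassPos κ`; mirror for down-dials under `ClusterBindersNeg`; both packages
  ⇒ `(K − 1)·w(q) = 0`; the `∃`-window idiom `ClusterReady q ρ` (`τ(1 + ρ) < ρ`, resp. `κ < ρ`) likewise;
* §2 (PROVED) the guarded RESIDUE and its readings: a separating `S ⊆ GaugeRatioClassPos τ` forces `ζ`'s guarded
  self-ratio bound; a deeply negative window of `ζ` relative to its own low plane refutes it; and the ZERO-SIDE
  reading of `PfPersistenceRatioIndexReading` holds VERBATIM from the guarded premise (it only ever used windows
  with `0 < N`): `ζ ∈ GaugeRatioClassPos τ` (`τ < 1`) ⇒ `𝒬` infinite ∨ `#𝒬 ≤ 1`; `2 ≤ #𝒬 < ∞` ⇒ `ζ` rejected.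
-/

set_option linter.dupNamespace false

noncomputable section

open Real Set Matrix
open Literature.NumberTheory.LFunctions.ZetaZeros

namespace Summit.RiemannHypothesis.RiemannHypothesis.Theorems.PfPersistence

/-! ## §1 Dial isolation in the guarded classes -/

/-- **PROVED — every up-dial amplitude is rejected at a binder window OF DIMENSION ≥ 2** (gauge conjunct).
[folklore] -/
theorem exists_upDial_not_mem_gaugeRatioAt_pos {q : ℕ} {W : ℕ → Window} {ρ C : ℝ} (hB : ClusterBinders q W ρ C)
    {τ : ℝ} (hτ0 : 0 ≤ τ) (hτ : τ < 1) (hρ : τ * C < ρ * (1 - τ)) {K : ℝ} (ht : 0 < 2 * (K - 1) * zetaWeights q) :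
    ∃ n, 0 < (W n).N ∧ datumOf (dial q K zetaWeights) ∉ gaugeRatioAt τ (W n) := by
  set t : ℝ := 2 * (K - 1) * zetaWeights q with ht_def
  have hgap : 0 < ρ * (1 - τ) - τ * C := by linarith
  obtain ⟨n, x, y, v₀, hx, hy, hxy, hv₀, hZ, hΘ, hZv, hρv⟩ :=
    hB.small (t * (ρ * (1 - τ) - τ * C) / 2) (by positivity)
  refine ⟨n, pos_of_orth_pair hx hy hxy, dial_not_mem_gaugeRatioAt_of_amplitude (hB.reaches n) hx hy hxy
    (by positivity) hB.cap_nonneg hZ hΘ hv₀ hZv hρv hτ0 hτ ht ?_⟩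
  have : τ * (t * (ρ * (1 - τ) - τ * C) / 2) + t * (ρ * (1 - τ) - τ * C) / 2 * (1 - τ)
      = t * (ρ * (1 - τ) - τ * C) / 2 := by ring
  rw [this]
  have hpos : 0 < t * (ρ * (1 - τ) - τ * C) := mul_pos ht hgap
  linarith

/-- **PROVED — UP-DIAL ISOLATION IN THE GUARDED CLASS `GaugeRatioClassPos τ`** modulo `ClusterBinders q W ρ C`
(`0 ≤ τ < 1`, `τC < ρ(1 − τ)`): no up-dial of `ζ` at `q` of any amplitude. [folklore] -/
theorem upDial_not_mem_gaugeRatioClassPos {q : ℕ} {W : ℕ → Window} {ρ C : ℝ} (hB : ClusterBinders q W ρ C)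
    {τ : ℝ} (hτ0 : 0 ≤ τ) (hτ : τ < 1) (hρ : τ * C < ρ * (1 - τ)) {K : ℝ} (ht : 0 < 2 * (K - 1) * zetaWeights q) :
    datumOf (dial q K zetaWeights) ∉ GaugeRatioClassPos τ := by
  obtain ⟨n, hN, hn⟩ := exists_upDial_not_mem_gaugeRatioAt_pos hB hτ0 hτ hρ ht
  exact fun h => hn (h (W n) hN)

/-- PROVED: mirror — every down-dial amplitude is rejected at a binder window of dimension `≥ 2`. [folklore] -/
theorem exists_downDial_not_mem_gaugeRatioAt_pos {q : ℕ} {W : ℕ → Window} {ρ C : ℝ}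
    (hB : ClusterBindersNeg q W ρ C) {τ : ℝ} (hτ0 : 0 ≤ τ) (hτ : τ < 1) (hρ : τ * C < ρ * (1 - τ)) {K : ℝ}
    (ht : 2 * (K - 1) * zetaWeights q < 0) :
    ∃ n, 0 < (W n).N ∧ datumOf (dial q K zetaWeights) ∉ gaugeRatioAt τ (W n) := by
  set t : ℝ := 2 * (K - 1) * zetaWeights q with ht_def
  have hgap : 0 < ρ * (1 - τ) - τ * C := by linarith
  have hs : 0 < -t := neg_pos.2 ht
  obtain ⟨n, x, y, v₀, hx, hy, hxy, hv₀, hZ, hΘ, hZv, hρv⟩ :=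
    hB.small (-t * (ρ * (1 - τ) - τ * C) / 2) (by positivity)
  refine ⟨n, pos_of_orth_pair hx hy hxy, dial_not_mem_gaugeRatioAt_of_amplitude_neg (hB.reaches n) hx hy hxy
    (by positivity) hB.cap_nonneg hZ hΘ hv₀ hZv hρv hτ0 hτ ht ?_⟩
  have : τ * (-t * (ρ * (1 - τ) - τ * C) / 2) + -t * (ρ * (1 - τ) - τ * C) / 2 * (1 - τ)
      = -t * (ρ * (1 - τ) - τ * C) / 2 := by ring
  rw [this]
  have hpos : 0 < -t * (ρ * (1 - τ) - τ * C) := mul_pos hs hgap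
  linarith

/-- **PROVED — DOWN-DIAL ISOLATION IN `GaugeRatioClassPos τ`** modulo `ClusterBindersNeg q W ρ C`. [folklore] -/
theorem downDial_not_mem_gaugeRatioClassPos {q : ℕ} {W : ℕ → Window} {ρ C : ℝ} (hB : ClusterBindersNeg q W ρ C)
    {τ : ℝ} (hτ0 : 0 ≤ τ) (hτ : τ < 1) (hρ : τ * C < ρ * (1 - τ)) {K : ℝ} (ht : 2 * (K - 1) * zetaWeights q < 0) :
    datumOf (dial q K zetaWeights) ∉ GaugeRatioClassPos τ := by
  obtain ⟨n, hN, hn⟩ := exists_downDial_not_mem_gaugeRatioAt_pos hB hτ0 hτ hρ ht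
  exact fun h => hn (h (W n) hN)

/-- **PROVED — BOTH PACKAGES: the only `q`-dial of `ζ` in the guarded class is the trivial one** (RULING A314 (1)
P3: one package alone gives only the one-sided exclusion). [folklore] -/
theorem dial_mem_gaugeRatioClassPos_imp_trivial {q : ℕ} {W W' : ℕ → Window} {ρ C ρ' C' : ℝ}
    (hB : ClusterBinders q W ρ C) (hB' : ClusterBindersNeg q W' ρ' C') {τ : ℝ} (hτ0 : 0 ≤ τ) (hτ : τ < 1)
    (hρ : τ * C < ρ * (1 - τ)) (hρ' : τ * C' < ρ' * (1 - τ)) {K : ℝ}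
    (hmem : datumOf (dial q K zetaWeights) ∈ GaugeRatioClassPos τ) : (K - 1) * zetaWeights q = 0 := by
  by_contra h
  rcases lt_or_gt_of_ne h with hlt | hgt
  · exact downDial_not_mem_gaugeRatioClassPos hB' hτ0 hτ hρ' (K := K) (by linarith) hmem
  · exact upDial_not_mem_gaugeRatioClassPos hB hτ0 hτ hρ (K := K) (by linarith) hmem

/-- **PROVED — `∃`-window idiom: up-dial isolation in `GaugeRatioClassPos τ` modulo `ClusterReady q ρ` ONLY**
(`0 ≤ τ < 1`, `τ(1 + ρ) < ρ`; the cap `C = 1` is free). [folklore] -/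
theorem upDial_not_mem_gaugeRatioClassPos_of_clusterReady {q : ℕ} {ρ : ℝ} (h : ClusterReady q ρ) {τ : ℝ}
    (hτ0 : 0 ≤ τ) (hτ : τ < 1) (hτρ : τ * (1 + ρ) < ρ) {K : ℝ} (ht : 0 < 2 * (K - 1) * zetaWeights q) :
    datumOf (dial q K zetaWeights) ∉ GaugeRatioClassPos τ := by
  obtain ⟨W, hW⟩ := h.exists_clusterBindersLight
  exact upDial_not_mem_gaugeRatioClassPos hW.toClusterBinders hτ0 hτ (by linarith) ht

/-- PROVED: down-dial isolation in `GaugeRatioClassPos τ` modulo `ClusterReadyNeg q ρ` only. [folklore] -/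
theorem downDial_not_mem_gaugeRatioClassPos_of_clusterReadyNeg {q : ℕ} {ρ : ℝ} (h : ClusterReadyNeg q ρ) {τ : ℝ}
    (hτ0 : 0 ≤ τ) (hτ : τ < 1) (hτρ : τ * (1 + ρ) < ρ) {K : ℝ} (ht : 2 * (K - 1) * zetaWeights q < 0) :
    datumOf (dial q K zetaWeights) ∉ GaugeRatioClassPos τ := by
  obtain ⟨W, hW⟩ := h.exists_clusterBindersNegLight
  exact downDial_not_mem_gaugeRatioClassPos hW.toClusterBindersNeg hτ0 hτ (by linarith) ht

/-- **PROVED — `∃`-window idiom, both packages ⇒ trivial dial.** [folklore] -/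
theorem dial_mem_gaugeRatioClassPos_imp_trivial_of_clusterReady {q : ℕ} {ρ ρ' : ℝ} (h : ClusterReady q ρ)
    (h' : ClusterReadyNeg q ρ') {τ : ℝ} (hτ0 : 0 ≤ τ) (hτ : τ < 1) (hτρ : τ * (1 + ρ) < ρ)
    (hτρ' : τ * (1 + ρ') < ρ') {K : ℝ} (hmem : datumOf (dial q K zetaWeights) ∈ GaugeRatioClassPos τ) :
    (K - 1) * zetaWeights q = 0 := by
  by_contra hne
  rcases lt_or_gt_of_ne hne with hlt | hgt
  · exact downDial_not_mem_gaugeRatioClassPos_of_clusterReadyNeg h' hτ0 hτ hτρ' (K := K) (by linarith) hmem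
  · exact upDial_not_mem_gaugeRatioClassPos_of_clusterReady h hτ0 hτ hτρ (K := K) (by linarith) hmem

/-- **PROVED — MODULUS conjunct: every up-dial amplitude is rejected at a binder window of dimension `≥ 2`.**
[folklore] -/
theorem exists_upDial_not_mem_modulusRatioAt_pos {q : ℕ} {W : ℕ → Window} {ρ C : ℝ} (hB : ClusterBinders q W ρ C)
    {κ : ℝ} (hκ0 : 0 ≤ κ) (hκ : κ < 1) (hκC : κ * C < ρ) {K : ℝ} (ht : 0 < 2 * (K - 1) * zetaWeights q) :
    ∃ n, 0 < (W n).N ∧ datumOf (dial q K zetaWeights) ∉ modulusRatioAt κ (W n) := by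
  set t : ℝ := 2 * (K - 1) * zetaWeights q with ht_def
  have hgap : 0 < t * (ρ - κ * C) := mul_pos ht (by linarith)
  obtain ⟨n, x, y, v₀, hx, hy, hxy, hv₀, hZ, hΘ, hZv, hρ⟩ := hB.small (t * (ρ - κ * C) / 4) (by positivity)
  refine ⟨n, pos_of_orth_pair hx hy hxy, fun hmem => ?_⟩
  refine dial_not_mem_modulusRatioAt_of_amplitude (hB.reaches n) hx hy hxy (by positivity) hB.cap_nonneg hZ hΘ
    hv₀ hZv hρ hκ0 hκ ht ?_ hmem
  nlinarith

/-- **PROVED — UP-DIAL ISOLATION IN `ModulusRatioClassPos κ`** modulo `ClusterBinders q W ρ C` (`κC < ρ`).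
[folklore] -/
theorem upDial_not_mem_modulusRatioClassPos {q : ℕ} {W : ℕ → Window} {ρ C : ℝ} (hB : ClusterBinders q W ρ C)
    {κ : ℝ} (hκ0 : 0 ≤ κ) (hκ : κ < 1) (hκC : κ * C < ρ) {K : ℝ} (ht : 0 < 2 * (K - 1) * zetaWeights q) :
    datumOf (dial q K zetaWeights) ∉ ModulusRatioClassPos κ := by
  obtain ⟨n, hN, hn⟩ := exists_upDial_not_mem_modulusRatioAt_pos hB hκ0 hκ hκC ht
  exact fun h => hn (h (W n) hN)

/-- PROVED: mirror for down-dials (modulus). [folklore] -/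
theorem exists_downDial_not_mem_modulusRatioAt_pos {q : ℕ} {W : ℕ → Window} {ρ C : ℝ}
    (hB : ClusterBindersNeg q W ρ C) {κ : ℝ} (hκ0 : 0 ≤ κ) (hκ : κ < 1) (hκC : κ * C < ρ) {K : ℝ}
    (ht : 2 * (K - 1) * zetaWeights q < 0) :
    ∃ n, 0 < (W n).N ∧ datumOf (dial q K zetaWeights) ∉ modulusRatioAt κ (W n) := by
  set t : ℝ := 2 * (K - 1) * zetaWeights q with ht_def
  have ht' : 0 < -t := by linarith
  have hgap : 0 < -t * (ρ - κ * C) := mul_pos ht' (by linarith)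
  obtain ⟨n, x, y, v₀, hx, hy, hxy, hv₀, hZ, hΘ, hZv, hρ⟩ := hB.small (-t * (ρ - κ * C) / 4) (by positivity)
  refine ⟨n, pos_of_orth_pair hx hy hxy, fun hmem => ?_⟩
  refine dial_not_mem_modulusRatioAt_of_amplitude_neg (hB.reaches n) hx hy hxy (by positivity) hB.cap_nonneg hZ
    hΘ hv₀ hZv hρ hκ0 hκ ht ?_ hmem
  nlinarith

/-- **PROVED — DOWN-DIAL ISOLATION IN `ModulusRatioClassPos κ`** modulo `ClusterBindersNeg q W ρ C`. [folklore] -/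
theorem downDial_not_mem_modulusRatioClassPos {q : ℕ} {W : ℕ → Window} {ρ C : ℝ} (hB : ClusterBindersNeg q W ρ C)
    {κ : ℝ} (hκ0 : 0 ≤ κ) (hκ : κ < 1) (hκC : κ * C < ρ) {K : ℝ} (ht : 2 * (K - 1) * zetaWeights q < 0) :
    datumOf (dial q K zetaWeights) ∉ ModulusRatioClassPos κ := by
  obtain ⟨n, hN, hn⟩ := exists_downDial_not_mem_modulusRatioAt_pos hB hκ0 hκ hκC ht
  exact fun h => hn (h (W n) hN)

/-- **PROVED — MODULUS, BOTH PACKAGES ⇒ trivial dial.** [folklore] -/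
theorem dial_mem_modulusRatioClassPos_imp_trivial {q : ℕ} {W W' : ℕ → Window} {ρ C ρ' C' : ℝ}
    (hB : ClusterBinders q W ρ C) (hB' : ClusterBindersNeg q W' ρ' C') {κ : ℝ} (hκ0 : 0 ≤ κ) (hκ : κ < 1)
    (hκC : κ * C < ρ) (hκC' : κ * C' < ρ') {K : ℝ}
    (hmem : datumOf (dial q K zetaWeights) ∈ ModulusRatioClassPos κ) : (K - 1) * zetaWeights q = 0 := by
  by_contra h
  rcases lt_or_gt_of_ne h with hlt | hgt
  · exact downDial_not_mem_modulusRatioClassPos hB' hκ0 hκ hκC' (K := K) (by linarith) hmem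
  · exact upDial_not_mem_modulusRatioClassPos hB hκ0 hκ hκC (K := K) (by linarith) hmem

/-- **PROVED — `∃`-window idiom (modulus): up-dial isolation modulo `ClusterReady q ρ` only** (`κ < ρ`).
[folklore] -/
theorem upDial_not_mem_modulusRatioClassPos_of_clusterReady {q : ℕ} {ρ : ℝ} (h : ClusterReady q ρ) {κ : ℝ}
    (hκ0 : 0 ≤ κ) (hκ : κ < 1) (hκρ : κ < ρ) {K : ℝ} (ht : 0 < 2 * (K - 1) * zetaWeights q) :
    datumOf (dial q K zetaWeights) ∉ ModulusRatioClassPos κ := by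
  obtain ⟨W, hW⟩ := h.exists_clusterBindersLight
  exact upDial_not_mem_modulusRatioClassPos hW.toClusterBinders hκ0 hκ (by linarith) ht

/-- PROVED: down-dial isolation modulo `ClusterReadyNeg q ρ` only (modulus). [folklore] -/
theorem downDial_not_mem_modulusRatioClassPos_of_clusterReadyNeg {q : ℕ} {ρ : ℝ} (h : ClusterReadyNeg q ρ)
    {κ : ℝ} (hκ0 : 0 ≤ κ) (hκ : κ < 1) (hκρ : κ < ρ) {K : ℝ} (ht : 2 * (K - 1) * zetaWeights q < 0) :
    datumOf (dial q K zetaWeights) ∉ ModulusRatioClassPos κ := by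
  obtain ⟨W, hW⟩ := h.exists_clusterBindersNegLight
  exact downDial_not_mem_modulusRatioClassPos hW.toClusterBindersNeg hκ0 hκ (by linarith) ht

/-- **PROVED — `∃`-window idiom (modulus), both packages ⇒ trivial dial.** [folklore] -/
theorem dial_mem_modulusRatioClassPos_imp_trivial_of_clusterReady {q : ℕ} {ρ ρ' : ℝ} (h : ClusterReady q ρ)
    (h' : ClusterReadyNeg q ρ') {κ : ℝ} (hκ0 : 0 ≤ κ) (hκ : κ < 1) (hκρ : κ < ρ) (hκρ' : κ < ρ') {K : ℝ}
    (hmem : datumOf (dial q K zetaWeights) ∈ ModulusRatioClassPos κ) : (K - 1) * zetaWeights q = 0 := by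
  by_contra hne
  rcases lt_or_gt_of_ne hne with hlt | hgt
  · exact downDial_not_mem_modulusRatioClassPos_of_clusterReadyNeg h' hκ0 hκ hκρ' (K := K) (by linarith) hmem
  · exact upDial_not_mem_modulusRatioClassPos_of_clusterReady h hκ0 hκ hκρ (K := K) (by linarith) hmem

/-- PROVED: every class inside the guarded gauge class misses every up-dial at `q`, modulo `ClusterReady q ρ` only.
[folklore] -/
theorem subset_gaugeRatioClassPos_disjoint_upDials_of_clusterReady {S : Set Datum} {τ : ℝ}
    (hS : S ⊆ GaugeRatioClassPos τ) {q : ℕ} {ρ : ℝ} (h : ClusterReady q ρ) (hτ0 : 0 ≤ τ) (hτ : τ < 1)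
    (hτρ : τ * (1 + ρ) < ρ) {K : ℝ} (ht : 0 < 2 * (K - 1) * zetaWeights q) : datumOf (dial q K zetaWeights) ∉ S :=
  fun hmem => upDial_not_mem_gaugeRatioClassPos_of_clusterReady h hτ0 hτ hτρ ht (hS hmem)

/-! ## §2 The guarded residue and its readings -/

/-- PROVED: a separating class inside the guarded gauge class FORCES `ζ`'s guarded self-ratio bound
`∀ win, 0 < win.N → |ε₁(ζ; win)| ≤ τ·(ε₂ − ε₁)(ζ; win)` — the `(Z)`-cell remainder, re-typed. [folklore] -/
theorem zeta_mem_gaugeRatioClassPos_of_separates {S D : Set Datum} {τ : ℝ} (hS : S ⊆ GaugeRatioClassPos τ)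
    (hsep : Separates S D zetaDatum) : zetaDatum ∈ GaugeRatioClassPos τ :=
  hS hsep.1

/-- PROVED: modulus twin. [folklore] -/
theorem zeta_mem_modulusRatioClassPos_of_separates {S D : Set Datum} {κ : ℝ} (hS : S ⊆ ModulusRatioClassPos κ)
    (hsep : Separates S D zetaDatum) : zetaDatum ∈ ModulusRatioClassPos κ :=
  hS hsep.1

/-- **PROVED — THE GUARDED REMAINDER'S ONLY FAILURE MODE**: a window where `ζ` carries a plane of height `≤ η₂`
and a vector more than `m`-negative with `τη₂ < m(1 − τ)` refutes `ζ ∈ GaugeRatioClassPos τ` (such a window has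
`0 < N` automatically). [folklore] -/
theorem zeta_not_mem_gaugeRatioClassPos_of_deep_negative {τ : ℝ} {win : Window} {x y : Fin (win.N + 1) → ℝ}
    (hx : x ≠ 0) (hy : y ≠ 0) (hxy : y ⬝ᵥ x = 0) {η₂ : ℝ}
    (hZ : ∀ α β : ℝ, (α • x + β • y) ⬝ᵥ (zetaDatum win *ᵥ (α • x + β • y))
      ≤ η₂ * ((α • x + β • y) ⬝ᵥ (α • x + β • y)))
    {v : Fin (win.N + 1) → ℝ} (hv : v ≠ 0) {m : ℝ} (hm : 0 < m)
    (hneg : v ⬝ᵥ (zetaDatum win *ᵥ v) ≤ -m * (v ⬝ᵥ v)) (hτ0 : 0 ≤ τ) (hτ : τ < 1)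
    (hdeep : τ * η₂ < m * (1 - τ)) : zetaDatum ∉ GaugeRatioClassPos τ := fun h =>
  zeta_not_mem_gaugeRatioAt_of_deep_negative hx hy hxy hZ hv hm hneg hτ0 hτ hdeep (h win (pos_of_orth_pair hx hy hxy))

/-- PROVED: hence no class inside the guarded gauge class separates `ζ` when such a window exists. [folklore] -/
theorem not_separates_of_subset_gaugeRatioClassPos_of_deep_negative {S D : Set Datum} {τ : ℝ}
    (hS : S ⊆ GaugeRatioClassPos τ) {win : Window} {x y : Fin (win.N + 1) → ℝ} (hx : x ≠ 0) (hy : y ≠ 0)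
    (hxy : y ⬝ᵥ x = 0) {η₂ : ℝ}
    (hZ : ∀ α β : ℝ, (α • x + β • y) ⬝ᵥ (zetaDatum win *ᵥ (α • x + β • y))
      ≤ η₂ * ((α • x + β • y) ⬝ᵥ (α • x + β • y)))
    {v : Fin (win.N + 1) → ℝ} (hv : v ≠ 0) {m : ℝ} (hm : 0 < m)
    (hneg : v ⬝ᵥ (zetaDatum win *ᵥ v) ≤ -m * (v ⬝ᵥ v)) (hτ0 : 0 ≤ τ) (hτ : τ < 1)
    (hdeep : τ * η₂ < m * (1 - τ)) : ¬ Separates S D zetaDatum := fun hsep =>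
  zeta_not_mem_gaugeRatioClassPos_of_deep_negative hx hy hxy hZ hv hm hneg hτ0 hτ hdeep (hS hsep.1)

/-- **PROVED — ZERO-SIDE READING FROM THE GUARDED PREMISE (gauge)**: `ζ ∈ GaugeRatioClassPos τ` (`0 ≤ τ < 1`) ⇒
the off-line zero quadrant is infinite or has at most one element. RH-free; premise NOT asserted. [folklore] -/
theorem quadrant_infinite_or_encard_le_one_of_zeta_mem_gaugeRatioClassPos {τ : ℝ} (hτ0 : 0 ≤ τ) (hτ : τ < 1)
    (h : zetaDatum ∈ GaugeRatioClassPos τ) :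
    {ρ : ℂ | ρ ∈ riemannZetaNontrivialZeros ∧ 1 / 2 < ρ.re ∧ 0 < ρ.im}.Infinite ∨
      {ρ : ℂ | ρ ∈ riemannZetaNontrivialZeros ∧ 1 / 2 < ρ.re ∧ 0 < ρ.im}.encard ≤ 1 :=
  quadrant_infinite_or_encard_le_one_of_secondRayleigh_nonneg fun win hN =>
    secondRayleigh_nonneg_of_mem_gaugeRatioAt hN hτ0 hτ (h win hN)

/-- PROVED: modulus twin. [folklore] -/
theorem quadrant_infinite_or_encard_le_one_of_zeta_mem_modulusRatioClassPos {κ : ℝ} (hκ0 : 0 ≤ κ) (hκ : κ < 1)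
    (h : zetaDatum ∈ ModulusRatioClassPos κ) :
    {ρ : ℂ | ρ ∈ riemannZetaNontrivialZeros ∧ 1 / 2 < ρ.re ∧ 0 < ρ.im}.Infinite ∨
      {ρ : ℂ | ρ ∈ riemannZetaNontrivialZeros ∧ 1 / 2 < ρ.re ∧ 0 < ρ.im}.encard ≤ 1 :=
  quadrant_infinite_or_encard_le_one_of_secondRayleigh_nonneg fun win hN =>
    secondRayleigh_nonneg_of_mem_modulusRatioAt hN hκ0 hκ (h win hN)

/-- PROVED: with finitely many off-line zeros the guarded gauge premise leaves at most one off-line quadruple.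
[folklore] -/
theorem card_le_one_of_zeta_mem_gaugeRatioClassPos
    (hfin : {ρ : ℂ | ρ ∈ riemannZetaNontrivialZeros ∧ 1 / 2 < ρ.re ∧ 0 < ρ.im}.Finite) {τ : ℝ} (hτ0 : 0 ≤ τ)
    (hτ : τ < 1) (h : zetaDatum ∈ GaugeRatioClassPos τ) : hfin.toFinset.card ≤ 1 :=
  card_le_one_of_secondRayleigh_nonneg hfin fun win hN => secondRayleigh_nonneg_of_mem_gaugeRatioAt hN hτ0 hτ (h win hN)

/-- PROVED: modulus twin. [folklore] -/
theorem card_le_one_of_zeta_mem_modulusRatioClassPos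
    (hfin : {ρ : ℂ | ρ ∈ riemannZetaNontrivialZeros ∧ 1 / 2 < ρ.re ∧ 0 < ρ.im}.Finite) {κ : ℝ} (hκ0 : 0 ≤ κ)
    (hκ : κ < 1) (h : zetaDatum ∈ ModulusRatioClassPos κ) : hfin.toFinset.card ≤ 1 :=
  card_le_one_of_secondRayleigh_nonneg hfin fun win hN =>
    secondRayleigh_nonneg_of_mem_modulusRatioAt hN hκ0 hκ (h win hN)

/-- **PROVED — `2 ≤ #𝒬 < ∞` ⇒ `ζ` is rejected by every guarded ∀-window gauge-ratio reader (`τ < 1`).**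
[folklore] -/
theorem zeta_not_mem_gaugeRatioClassPos_of_two_le_card
    (hfin : {ρ : ℂ | ρ ∈ riemannZetaNontrivialZeros ∧ 1 / 2 < ρ.re ∧ 0 < ρ.im}.Finite)
    (h2 : 2 ≤ hfin.toFinset.card) {τ : ℝ} (hτ0 : 0 ≤ τ) (hτ : τ < 1) : zetaDatum ∉ GaugeRatioClassPos τ :=
  fun h => absurd (card_le_one_of_zeta_mem_gaugeRatioClassPos hfin hτ0 hτ h) (by omega)

/-- PROVED: modulus twin. [folklore] -/
theorem zeta_not_mem_modulusRatioClassPos_of_two_le_card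
    (hfin : {ρ : ℂ | ρ ∈ riemannZetaNontrivialZeros ∧ 1 / 2 < ρ.re ∧ 0 < ρ.im}.Finite)
    (h2 : 2 ≤ hfin.toFinset.card) {κ : ℝ} (hκ0 : 0 ≤ κ) (hκ : κ < 1) : zetaDatum ∉ ModulusRatioClassPos κ :=
  fun h => absurd (card_le_one_of_zeta_mem_modulusRatioClassPos hfin hκ0 hκ h) (by omega)

/-- **PROVED — a separating class inside the GUARDED gauge class places `ζ`'s zeros**: `𝒬` infinite ∨ `#𝒬 ≤ 1`.
[folklore] -/
theorem quadrant_infinite_or_encard_le_one_of_separates_gaugeRatioPos {S D : Set Datum} {τ : ℝ}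
    (hS : S ⊆ GaugeRatioClassPos τ) (hτ0 : 0 ≤ τ) (hτ : τ < 1) (hsep : Separates S D zetaDatum) :
    {ρ : ℂ | ρ ∈ riemannZetaNontrivialZeros ∧ 1 / 2 < ρ.re ∧ 0 < ρ.im}.Infinite ∨
      {ρ : ℂ | ρ ∈ riemannZetaNontrivialZeros ∧ 1 / 2 < ρ.re ∧ 0 < ρ.im}.encard ≤ 1 :=
  quadrant_infinite_or_encard_le_one_of_zeta_mem_gaugeRatioClassPos hτ0 hτ (hS hsep.1)

/-- PROVED: modulus twin. [folklore] -/
theorem quadrant_infinite_or_encard_le_one_of_separates_modulusRatioPos {S D : Set Datum} {κ : ℝ}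
    (hS : S ⊆ ModulusRatioClassPos κ) (hκ0 : 0 ≤ κ) (hκ : κ < 1) (hsep : Separates S D zetaDatum) :
    {ρ : ℂ | ρ ∈ riemannZetaNontrivialZeros ∧ 1 / 2 < ρ.re ∧ 0 < ρ.im}.Infinite ∨
      {ρ : ℂ | ρ ∈ riemannZetaNontrivialZeros ∧ 1 / 2 < ρ.re ∧ 0 < ρ.im}.encard ≤ 1 :=
  quadrant_infinite_or_encard_le_one_of_zeta_mem_modulusRatioClassPos hκ0 hκ (hS hsep.1)

/-- **PROVED — in the world `2 ≤ #𝒬 < ∞` NO class inside the guarded gauge class (`τ < 1`) separates `ζ`.**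
[folklore] -/
theorem not_separates_of_subset_gaugeRatioClassPos_of_two_le_card {S D : Set Datum} {τ : ℝ}
    (hS : S ⊆ GaugeRatioClassPos τ) (hτ0 : 0 ≤ τ) (hτ : τ < 1)
    (hfin : {ρ : ℂ | ρ ∈ riemannZetaNontrivialZeros ∧ 1 / 2 < ρ.re ∧ 0 < ρ.im}.Finite)
    (h2 : 2 ≤ hfin.toFinset.card) : ¬ Separates S D zetaDatum :=
  fun hsep => zeta_not_mem_gaugeRatioClassPos_of_two_le_card hfin h2 hτ0 hτ (hS hsep.1)

/-- PROVED: modulus twin. [folklore] -/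
theorem not_separates_of_subset_modulusRatioClassPos_of_two_le_card {S D : Set Datum} {κ : ℝ}
    (hS : S ⊆ ModulusRatioClassPos κ) (hκ0 : 0 ≤ κ) (hκ : κ < 1)
    (hfin : {ρ : ℂ | ρ ∈ riemannZetaNontrivialZeros ∧ 1 / 2 < ρ.re ∧ 0 < ρ.im}.Finite)
    (h2 : 2 ≤ hfin.toFinset.card) : ¬ Separates S D zetaDatum :=
  fun hsep => zeta_not_mem_modulusRatioClassPos_of_two_le_card hfin h2 hκ0 hκ (hS hsep.1)

end Summit.RiemannHypothesis.RiemannHypothesis.Theorems.PfPersistence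

end
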